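import Literature.AlgebraicGeometry.Frobenioids.ArchimedeanProp35iToyBase
import Literature.AlgebraicGeometry.Frobenioids.ArchimedeanTheoremsInstances
import Literature.AlgebraicGeometry.Frobenioids.ArchimedeanFrobenioidStatements
import Literature.AlgebraicGeometry.Frobenioids.ArchimedeanProp35iCounterexample
import HarnessLib

/-!
# [FrdII] Proposition 3.5 (i) AS TYPED (`ArchFrd.Prop35i_C π`) fails for a base functor `π : D → D₀`
# that kills a quotient group — a kernel COUNTEREXAMPLE (statement-level finding P35i-F1)

Mochizuki, *The geometry of Frobenioids II: poly-Frobenioids*, Kyushu J. Math. **62** (2008)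
401–460, §3, Proposition 3.5 (i), author's (kurims) text p. 34 ll. 6–27
[cite: MochizukiFrdII2008, Prop 3.5 (i) p.34]:

> "(i) Let `A ∈ Ob(H)`; suppose that `B_D → A_D := Base(A)` is a mono-minimal categorical quotient of
> `B_D` by a group `G_D ⊆ Aut_D(B_D)` in `D`. Then there exists a pull-back morphism `B → A` that
> lifts `B_D → A_D` and a group `G ⊆ Aut_H(B)` that maps isomorphically to `G_D` such that `B → A`
> is a mono-minimal categorical quotient of `B` by `G` in `H`."

and its proof (p. 34 ll. 18–27): "the natural surjection `Aut_{(H₀)_{A₀}}(B₀) → Aut_{(D₀)_{A_{D₀}}}(B_{D₀})`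
splits, hence there exists a group `G ⊆ Aut_{H_A}(B)` that maps isomorphically to `G_D`. Since
`B_D → A_D` is a categorical quotient of `B_D` by `G_D` in `D`, it follows again from the simple,
explicit structure of `H₀` […] that `B → A` is a categorical quotient of `B` by `G` in `H`."

**What this file proves (abc-iut cell, layer L1, sub-DAG `SUBDAG-FrdII-Thm36-Prop35`, rows
P35-L01/L02; finding P35i-F1, seat abc-iut-w5-d013).** The second quoted step uses that `G_D` SURJECTS
onto `Aut_{(D₀)_{A_{D₀}}}(B_{D₀})`: if `B_{D₀} = Spec ℂ`, `A_{D₀} = Spec ℝ` but every element of `G_D`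
maps to the identity of `Spec ℂ`, then a `G`-invariant arrow out of `B` in `C = C₀ ×_{D₀} D` need not
have a real (Galois-fixed) scalar and does not factor through the pull-back `B → A`. The typed statement
`ArchFrd.Prop35i` (seat abc-iut-L1-t9, `ArchimedeanIsoSubanchors.lean`) quantifies over an ARBITRARY
functor `π : D ⥤ D₀` subject only to "`D` is of RC-iso-subanchor type", so its instance
`ArchFrd.P35iToy.toD0 : T ⥤ D₀` of `ArchimedeanProp35iToyBase.lean` (`σ ↦ 𝟙`) refutes its instance
`ArchFrd.Prop35i_C π` (`ArchimedeanTheoremsInstances.lean`) — and does so for a base of RC-STANDARD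
type ([FrdII] Def. 3.1 (v): RC-connected, complexifiable, FSMFF, RC-iso-subanchor), i.e. under ALL the
standing hypotheses on `D` of [FrdII] Thm. 3.6. (The sibling file `ArchimedeanProp35iCounterexample.lean`,
seat abc-iut-w4-d100, found independently, refutes the same instance at `D := D₀` with the
conjugation-collapsing functor, which is not complexifiable; the two files share no declaration except that this one REUSES its scalar `ArchFrd.unitI = i` and the two lemmas about it.)

* `isOfRCIsoSubanchorType`, `isComplexifiable`, `isRCConnected`, `T.isOfFSMFFType`, packaged as
  `isOfRCStandardType : RC.IsOfRCStandardType (baseRC toD0)` — `D = T` with `π = toD0` is of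
  RC-standard type ([FrdII] Def. 3.1 (v): `b` is an RC-anchor, `a` is reached by the mono-minimal
  quotient `b → a` by `G_D = {1, σ}`; `τ` over `a` lifts conjugation; every mono of `T` is invertible),
  although `π(G_D) = {𝟙}`.
* `not_prop35i_C : ¬ ArchFrd.Prop35i_C toD0` — for the REAL object `A = (A₀, a)` of `C toD0`, no data
  `(B, f, e, Γ, φ)` as in the conclusion exists: `Γ ≅ G_D` forces every `γ ∈ Γ` to act on the
  `C₀`-component of `B` over the identity of `Spec ℂ` fixing `f`, hence trivially on scalars; the arrow
  `ψ := (f₀` with scalar multiplied by `i`, `b → a)` is then `Γ`-invariant, but `ψ = f ≫ g` would force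
  an endomorphism `g` of the real object `A` with scalar `i ∉ ℝ^×`. (Only clause (a) and the universal
  property (b) of "categorical quotient" are used; the pull-back property of `f` is not needed.)
* `exists_counterexample` — the packaged existential.

**Reading (neutral; the repaired form).** This is a finding about the statement AS TYPED over our
renderings (and about the generality in which p. 34 is phrased), not about the use of Prop. 3.5 in
[FrdII]/[IUTchI]: for base categories of geometric origin (connected objects of a Galois category,
temperoids) a mono-minimal categorical quotient by `G_D` is the quotient BY `G_D`, so `G_D` surjects
onto the Galois group of the constant-field extension and the printed argument applies. The repaired
statement adds exactly this hypothesis — "`π` maps `G_D` onto `Aut_{(D₀)_{π A_D}}(π B_D)`" (or: `π`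
faithful) — and is the form to be discharged (abc-iut-L1-lead R77 (2), row M19).
No new `Prop`-valued fact is introduced; nothing here bears on [IUTchIII] Cor. 3.12; typed ≠ proved.
-/

namespace Literature.AlgebraicGeometry.Frobenioids

open CategoryTheory

noncomputable section

namespace ArchFrd

namespace P35iToy

open T

/-! ### RC-structure of the toy base for `π = toD0` ([FrdII] Def. 3.1 (v)) -/

/-- `b` is a complex object of `D` (for the RC-structure `π ⋙ D0.toArchBase`).
[cite: MochizukiFrdII2008, Def 3.1 (v) p.24] -/
theorem complexObjects_b : RC.complexObjects (baseRC toD0) b :=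
  (D0.complexObjects_comp_iff toD0 b).mpr rfl

/-- `a` is a real object of `D`. [cite: MochizukiFrdII2008, Def 3.1 (v) p.24] -/
theorem realObjects_a : RC.realObjects (baseRC toD0) a :=
  (D0.realObjects_comp_iff toD0 a).mpr rfl

/-- `a` is not a complex object of `D`. [cite: MochizukiFrdII2008, Def 3.1 (v) p.24] -/
theorem not_complexObjects_a : ¬ RC.complexObjects (baseRC toD0) a := by
  intro h
  have h1 : D0.real = D0.complex := (D0.complexObjects_comp_iff toD0 a).mp h
  cases h1

/-- `b` is not a real object of `D`. [cite: MochizukiFrdII2008, Def 3.1 (v) p.24] -/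
theorem not_realObjects_b : ¬ RC.realObjects (baseRC toD0) b := by
  intro h
  have h1 : D0.complex = D0.real := (D0.realObjects_comp_iff toD0 b).mp h
  cases h1

/-- An object of `D[ℂ]` is (over) `b`. [cite: MochizukiFrdII2008, Def 3.1 (v) p.24] -/
theorem eq_b_of_complexObjects {X : T} (h : RC.complexObjects (baseRC toD0) X) : X = b := by
  cases X
  · rfl
  · exact absurd h not_complexObjects_a

/-- In the full subcategory `D[ℂ]` every arrow out of `b` is an isomorphism.
[cite: MochizukiFrdII2008, Def 3.1 (v) p.25] -/
theorem isIso_of_complexPart (Y : RC.ComplexPart (baseRC toD0))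
    (φ : (⟨b, complexObjects_b⟩ : RC.ComplexPart (baseRC toD0)) ⟶ Y) : IsIso φ := by
  obtain ⟨Y, hY⟩ := Y
  obtain rfl := eq_b_of_complexObjects hY
  obtain ⟨s, t, h⟩ := hom_bb_eq φ.hom
  refine ⟨⟨InducedCategory.homMk (au s t), ?_, ?_⟩⟩
  · apply InducedCategory.hom_ext
    change φ.hom ≫ au s t = 𝟙 b
    rw [h]
    exact (autoIso s t).hom_inv_id
  · apply InducedCategory.hom_ext
    change au s t ≫ φ.hom = 𝟙 b
    rw [h]
    exact (autoIso s t).inv_hom_id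

/-- `b` is an RC-anchor: no irreducible arrow leaves `b` inside `D[ℂ]` (they are all isomorphisms),
so the set of isomorphism classes they reach is empty, hence finite.
[cite: MochizukiFrdII2008, Def 3.1 (v) p.25] -/
theorem isRCAnchor_b : RC.IsRCAnchor (baseRC toD0) b := by
  refine ⟨complexObjects_b, Set.finite_empty.subset ?_⟩
  rintro x ⟨g, hirr, -⟩
  exact absurd (isIso_of_complexPart g.right g.hom) hirr.1

/-- `b` is an RC-subanchor. [cite: MochizukiFrdII2008, Def 3.1 (v) p.25] -/
theorem isRCSubanchor_b : RC.IsRCSubanchor (baseRC toD0) b :=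
  ⟨b, isRCAnchor_b, ⟨𝟙 b⟩⟩

/-- `b` is an RC-iso-subanchor (via the identity, a mono-minimal quotient by the trivial group).
[cite: MochizukiFrdII2008, Def 3.1 (v) p.25] -/
theorem isRCIsoSubanchor_b : RC.IsRCIsoSubanchor (baseRC toD0) b :=
  ⟨b, ⊥, 𝟙 b, isRCSubanchor_b, isTotallyEpimorphic.isMonoMinimalQuotient_bot_of_isIso (𝟙 b)⟩

/-- `a` is an RC-iso-subanchor (via `b → a`, a mono-minimal quotient by `G_D`).
[cite: MochizukiFrdII2008, Def 3.1 (v) p.25] -/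
theorem isRCIsoSubanchor_a : RC.IsRCIsoSubanchor (baseRC toD0) a :=
  ⟨b, GD, fHom, isRCSubanchor_b, isMonoMinimalQuotient_fHom⟩

/-- `D` is of RC-iso-subanchor type for `π = toD0` — the only hypothesis of the typed Prop. 3.5 (i).
[cite: MochizukiFrdII2008, Def 3.1 (v) p.25] -/
theorem isOfRCIsoSubanchorType : RC.IsOfRCIsoSubanchorType (baseRC toD0) :=
  ⟨fun X => by
    cases X
    · exact isRCIsoSubanchor_b
    · exact isRCIsoSubanchor_a⟩

/-- `D` is moreover complexifiable: `τ` over `a` lifts complex conjugation.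
[cite: MochizukiFrdII2008, Def 3.1 (v) p.25] -/
theorem isComplexifiable : RC.IsComplexifiable (baseRC toD0) := by
  refine ⟨fun X hX => ?_⟩
  cases X
  · exact absurd hX not_realObjects_b
  · refine ⟨b, fHom, tau, complexObjects_b, Subsingleton.elim _ _, ?_⟩
    haveI : D0.toArchBase.Faithful := D0.toArchBase_faithful
    change D0.toArchBase.map D0.conj ≠ 𝟙 (D0.toArchBase.obj D0.complex)
    rw [← D0.toArchBase.map_id]
    exact fun h => D0.conj_ne_id (D0.toArchBase.map_injective h)

/-- Every monomorphism of `T` is an isomorphism (`b → a` is not mono; the rest are automorphisms).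
[cite: MochizukiFrdI2008, §0 p.14] -/
theorem T.isIso_of_mono {X Y : T} (φ : X ⟶ Y) [hφ : Mono φ] : IsIso φ := by
  cases φ with
  | auto s t => exact ⟨⟨au s t, (autoIso s t).hom_inv_id, (autoIso s t).inv_hom_id⟩⟩
  | f => exact absurd hφ not_mono_fHom
  | ida => exact (inferInstance : IsIso (𝟙 a))

/-- `T` is of FSM-type (every FSM-morphism, being mono, is an isomorphism).
[cite: MochizukiFrdI2008, §0 p.17] -/
theorem T.isOfFSMType : IsOfFSMType T :=
  ⟨fun φ hφ => by haveI := hφ.2; exact T.isIso_of_mono φ⟩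

/-- `T` is of FSMFF-type. [cite: MochizukiFrdI2008, §0 p.18] -/
theorem T.isOfFSMFFType : IsOfFSMFFType T := T.isOfFSMType.isOfFSMFFType

/-- An object of `D[ℝ]` is (over) `a`. [cite: MochizukiFrdII2008, Def 3.1 (v) p.24] -/
theorem eq_a_of_realObjects {X : T} (h : RC.realObjects (baseRC toD0) X) : X = a := by
  cases X
  · exact absurd h not_realObjects_b
  · rfl

/-- `D = T` is RC-connected for `π = toD0`: connected, with `D[ℝ] = {a}` and `D[ℂ] = {b}` connected.
[cite: MochizukiFrdII2008, Def 3.1 (v) p.25] -/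
theorem isRCConnected : RC.IsRCConnected (baseRC toD0) := by
  refine ⟨isConnected, Or.inr ?_, Or.inr ?_⟩
  · haveI : Nonempty (RC.RealPart (baseRC toD0)) := ⟨⟨a, realObjects_a⟩⟩
    refine zigzag_isConnected fun X Y => ?_
    obtain ⟨X, hX⟩ := X
    obtain ⟨Y, hY⟩ := Y
    obtain rfl := eq_a_of_realObjects hX
    obtain rfl := eq_a_of_realObjects hY
    exact Zigzag.refl _
  · haveI : Nonempty (RC.ComplexPart (baseRC toD0)) := ⟨⟨b, complexObjects_b⟩⟩
    refine zigzag_isConnected fun X Y => ?_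
    obtain ⟨X, hX⟩ := X
    obtain ⟨Y, hY⟩ := Y
    obtain rfl := eq_b_of_complexObjects hX
    obtain rfl := eq_b_of_complexObjects hY
    exact Zigzag.refl _

/-- **`D = T` with `π = toD0` is of RC-STANDARD type** ([FrdII] Def. 3.1 (v) (a)–(d) for the totally
epimorphic category `T`) — all the standing hypotheses on the base in [FrdII] Thm. 3.6.
[cite: MochizukiFrdII2008, Def 3.1 (v) p.25] -/
theorem isOfRCStandardType : RC.IsOfRCStandardType (baseRC toD0) :=
  ⟨isTotallyEpimorphic, isRCConnected, isComplexifiable, T.isOfFSMFFType, isOfRCIsoSubanchorType⟩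

/-! ### The real object `A` of `C = C₀ ×_{D₀} D` over `a`, and the contradiction -/

/-- The real object `A₀ = (Spec ℝ, ℝ, [-1, 1] ∖ {0})` of `C₀` (its region recorded, as in
`ArchimedeanFrobenioids.lean`, by the complexified isotropic disc of tip `1`).
[cite: MochizukiFrdII2008, Ex 3.3 (i) p.27] -/
abbrev A0 : C0 where
  base := .real
  region := AngularRegion.isotropicOfTip ⟨1, one_pos⟩
  isIsotropic_of_isReal _ := AngularRegion.isIsotropic_isotropicOfTip _

/-- The object `A := (A₀, a)` of `C = C₀ ×_{D₀} D` (the identification `Spec ℝ = π(a)` is the identity).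
[cite: MochizukiFrdII2008, Ex 3.3 (i) p.28] -/
abbrev Areal : C toD0 where
  fst := A0
  snd := a
  iso := Iso.refl _

/-- The base change of the region of `A₀` along any arrow is its (isotropic) carrier.
[cite: MochizukiFrdII2008, Def 3.1 (iv) p.24] -/
theorem pullRegion_A0 {L : D0} (g : L ⟶ A0.base) : C0.pullRegion A0 g = A0.region.carrier := by
  unfold C0.pullRegion D0.Hom.act
  exact C0.image_galAct_of_isIsotropic (AngularRegion.isIsotropic_isotropicOfTip _) _

/-- Membership in the region of `A₀`: absolute value at most `1`.
[cite: MochizukiFrdII2008, Def 3.1 (iii) p.24] -/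
theorem mem_region_A0_iff (u : ℂˣ) :
    u ∈ A0.region.carrier ↔ absHom ℂ u ≤ (⟨1, one_pos⟩ : PosReal) :=
  C0.mem_carrier_of_isIsotropic (AngularRegion.isIsotropic_isotropicOfTip _) u

/-- Twisting an arrow `X → A₀` of `C₀` with COMPLEX domain by the scalar `i`: same base and Frobenius
degree, scalar multiplied by `i` (the target region is an isotropic disc, so the image still fits).
[cite: MochizukiFrdII2008, Ex 3.3 (i) p.27] -/
def twistI {X : C0} (hX : X.base = .complex) (f₀ : X ⟶ A0) : X ⟶ A0 where
  base := C0.Base f₀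
  degFr := C0.degFr f₀
  scalar := ArchFrd.unitI * C0.scalar f₀
  scalar_mem := by rw [hX]; exact Subgroup.mem_top _
  mapsTo := by
    have hf := f₀.mapsTo
    rw [pullRegion_A0] at hf ⊢
    intro x hx
    obtain ⟨y, hy, rfl⟩ := Set.mem_smul_set.mp hx
    have h1 : C0.scalar f₀ • y ∈ A0.region.carrier := hf (Set.smul_mem_smul_set hy)
    rw [mem_region_A0_iff, smul_eq_mul] at h1 ⊢
    rw [mul_assoc, map_mul, ArchFrd.absHom_unitI, one_mul]
    exact h1

/-- Data of the twisted arrow. [cite: MochizukiFrdII2008, Ex 3.3 (i) p.27] -/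
@[simp] theorem base_twistI {X : C0} (hX : X.base = .complex) (f₀ : X ⟶ A0) :
    C0.Base (twistI hX f₀) = C0.Base f₀ := rfl

/-- Data of the twisted arrow. [cite: MochizukiFrdII2008, Ex 3.3 (i) p.27] -/
@[simp] theorem degFr_twistI {X : C0} (hX : X.base = .complex) (f₀ : X ⟶ A0) :
    C0.degFr (twistI hX f₀) = C0.degFr f₀ := rfl

/-- Data of the twisted arrow. [cite: MochizukiFrdII2008, Ex 3.3 (i) p.27] -/
@[simp] theorem scalar_twistI {X : C0} (hX : X.base = .complex) (f₀ : X ⟶ A0) :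
    C0.scalar (twistI hX f₀) = ArchFrd.unitI * C0.scalar f₀ := rfl

/-- An arrow `γ₀ : X → X` of `C₀` over the IDENTITY of its base with `γ₀ ≫ f₀ = f₀` also fixes the
`i`-twist of `f₀` (it has Frobenius degree `1` and `scalar^{deg f₀} = 1`, and it does not conjugate).
[cite: MochizukiFrdII2008, Ex 3.3 (i) p.27] -/
theorem comp_twistI_eq {X : C0} (hX : X.base = .complex) (f₀ : X ⟶ A0) (γ₀ : X ⟶ X)
    (hbase : C0.Base γ₀ = 𝟙 X.base) (hγ : γ₀ ≫ f₀ = f₀) : γ₀ ≫ twistI hX f₀ = twistI hX f₀ := by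
  have hdeg : C0.degFr γ₀ = 1 := by
    have h := congrArg C0.degFr hγ
    rw [C0.degFr_comp'] at h
    exact mul_right_cancel (h.trans (one_mul _).symm)
  have hsc : C0.scalar γ₀ ^ (C0.degFr f₀ : ℕ) = 1 := by
    have h := congrArg C0.scalar hγ
    rw [C0.scalar_comp'] at h
    unfold D0.Hom.act at h
    rw [hbase, D0.twists_id, D0.galAct_false] at h
    exact mul_eq_left.mp h
  refine C0.hom_ext ?_ ?_ ?_
  · rw [C0.base_comp', base_twistI, hbase, Category.id_comp]
  · rw [C0.degFr_comp', hdeg, one_mul]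
  · rw [C0.scalar_comp', degFr_twistI, scalar_twistI, hsc, mul_one]
    unfold D0.Hom.act
    rw [hbase, D0.twists_id, D0.galAct_false]

/-- **[FrdII] Prop. 3.5 (i) as typed is FALSE for the base functor `toD0 : T → D₀`**: for the real
object `A = (A₀, a)` of `C = C₀ ×_{D₀} D` and the mono-minimal categorical quotient `b → a` of `b` by
`G_D = {1, σ}` (with `π(σ) = 𝟙`), there are NO `B`, pull-back `f : B → A`, `e`, `Γ ≅ G_D` with `f` a
mono-minimal categorical quotient of `B` by `Γ` — indeed not even a categorical quotient: the
`i`-twist of `f` is `Γ`-invariant and does not factor through `f`.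
[cite: MochizukiFrdII2008, Prop 3.5 (i) p.34] -/
theorem not_prop35i_C : ¬ Prop35i_C toD0 := by
  intro h
  obtain ⟨B, f, e, Γ, φ, -, -, hΓ, hmm⟩ :=
    h isOfRCIsoSubanchorType Areal b fHom GD isMonoMinimalQuotient_fHom
  obtain ⟨B₀, BD, isoB⟩ := B
  cases BD with
  | a => exact (isEmpty_hom_ab.false e.hom).elim
  | b =>
    obtain ⟨K, R, hR⟩ := B₀
    cases K with
    | real => exact (D0.isEmpty_hom_real_complex.false isoB.hom).elim
    | complex =>
      -- every `γ ∈ Γ` has `D`-component in `G_D` (τ-bit `false`) …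
      have hτ : ∀ γ ∈ Γ, tauBit γ.hom.snd = false := fun γ hγ =>
        tauBit_eq_false_of_comm (hΓ ⟨γ, hγ⟩) ((mem_GD_iff _).mp (φ ⟨γ, hγ⟩).2)
      -- … hence its `C₀`-component lies over the identity of `Spec ℂ`
      have hbase : ∀ γ ∈ Γ, C0.Base γ.hom.fst = 𝟙 _ := by
        intro γ hγ
        have hs : toD0.map γ.hom.snd = 𝟙 D0.complex := by
          obtain ⟨s, t, hst⟩ := hom_bb_eq γ.hom.snd
          have ht := hτ γ hγ
          rw [hst, tauBit_au] at ht
          rw [hst, toD0_map_au, ht]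
          rfl
        exact D0_eq_id_of_comm γ.hom.w hs
      -- the Γ-invariant arrow ψ = (i-twist of f₀, b → a)
      let ψ : (⟨⟨D0.complex, R, hR⟩, b, isoB⟩ : C toD0) ⟶ Areal :=
        ⟨twistI rfl f.fst, fHom, (D0.hom_complex_real_eq _).trans (D0.hom_complex_real_eq _).symm⟩
      have hψ : ∀ γ ∈ Γ, γ.hom ≫ ψ = ψ := by
        intro γ hγ
        have hγf : (γ.hom ≫ f).fst = f.fst := congrArg CFP.Hom.fst (hmm.1.1 γ hγ)
        refine CFP.hom_ext ?_ (Subsingleton.elim _ _)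
        exact comp_twistI_eq rfl f.fst γ.hom.fst (hbase γ hγ) hγf
      obtain ⟨g, hg, -⟩ := hmm.1.2 ψ hψ
      -- `f ≫ g = ψ` forces the scalar `i` on the real endomorphism `g.fst` of `A₀`
      have hg₁ : f.fst ≫ g.fst = twistI rfl f.fst := congrArg CFP.Hom.fst hg
      have hdeg : C0.degFr g.fst = 1 := by
        have h := congrArg C0.degFr hg₁
        rw [C0.degFr_comp', degFr_twistI] at h
        exact mul_left_cancel (h.trans (mul_one _).symm)
      have hb : C0.Base f.fst = D0.toRealHom := D0.hom_complex_real_eq _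
      have hsc := congrArg C0.scalar hg₁
      rw [C0.scalar_comp', scalar_twistI, hdeg, PNat.one_coe, pow_one, hb] at hsc
      unfold D0.Hom.act at hsc
      rw [D0.twists_toRealHom, D0.galAct_false] at hsc
      have hgi : C0.scalar g.fst = ArchFrd.unitI := mul_right_cancel hsc
      have hm : C0.scalar g.fst ∈ D0.scalars D0.real := g.fst.scalar_mem
      rw [hgi] at hm
      exact ArchFrd.unitI_not_mem_scalars_real hm

/-- Under the layer's named statement «`C` is a Frobenioid» ([FrdII] Ex. 3.3 (ii), abc-iut-L1-t6's
`ArchFrd.Ex33ii_isFrobenioid`, taken BY NAME as a hypothesis per abc-iut-L1-lead R78 (2)) the toy base still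
refutes Prop. 3.5 (i) as typed WHILE `C toD0` is a Frobenioid (the toy base is connected and totally
epimorphic): adding `IsFrobenioid` alone does not repair the statement — the Galois-saturation of `G_D`
is the missing hypothesis. [cite: MochizukiFrdII2008, Prop 3.5 (i) p.34] -/
theorem isFrobenioid_and_not_prop35i_C (h33 : Ex33ii_isFrobenioid toD0) :
    PreFrobenioid.IsFrobenioid (C.toElem toD0) ∧ ¬ Prop35i_C toD0 :=
  ⟨h33 isGraphConnected isTotallyEpimorphic, not_prop35i_C⟩

/-- **Packaged finding P35i-F1.** There is a connected, totally epimorphic base category `D` with a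
functor `π : D → D₀` for which `D` is of RC-STANDARD type ([FrdII] Def. 3.1 (v)), and the typed
[FrdII] Prop. 3.5 (i) for `H = C` (`ArchFrd.Prop35i_C π`) FAILS. The printed proof's step "it follows
again from the simple, explicit structure of `H₀` … that `B → A` is a categorical quotient of `B` by
`G` in `H`" needs `G_D ↠ Aut_{(D₀)_{A_{D₀}}}(B_{D₀})`, which this `π` violates (`π(σ) = 𝟙`).
[cite: MochizukiFrdII2008, Prop 3.5 (i) p.34] -/
theorem exists_counterexample :
    ∃ (D : Type) (_ : Category.{0} D) (π : D ⥤ D0),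
      IsConnected D ∧ IsTotallyEpimorphic D ∧ RC.IsOfRCStandardType (baseRC π) ∧ ¬ Prop35i_C π :=
  ⟨T, inferInstance, toD0, isConnected, isTotallyEpimorphic, isOfRCStandardType, not_prop35i_C⟩

end P35iToy

end ArchFrd

end

end Literature.AlgebraicGeometry.Frobenioids
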